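import Summits.CriticalPhenomena.Ising3DConformalLimit.Theorems.PerfectScreeningGaussianLimitNotScreenedDyadicShellSums
import Summits.CriticalPhenomena.Ising3DConformalLimit.Theorems.GaussianLimitNotScreened.Negative.Reformulation
import Literature.Probability.LatticeModels.CriticalTwoPointDCPLowerHolds
import HarnessLib

/-!
# Crux `GaussianLimitNotScreened` (stmt-CriticalPhenomena-13886), line `free-regular-variation-dcp-window`:
# the amplitude-sharp Duminil-Copin–Panis floor (registered bookkeeping stub `stub_amplitudeFloorDCP`, lead c5 / P1)

THEOREM-ONLY helper file (no definitions). For every non-degenerate Möbius-covariant pointwise scaling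
limit `(ρ, Δ, S)` of the critical nearest-neighbour Ising correlators `criticalCorr 3` on `ℤ³` (any `Δ`,
any renormalisation `ρ > 0`, no Gaussianity assumed), the axial critical two-point function
`G(n e₀) = ⟨σ₀σ_{n e₀}⟩⁺_{β_c}` (`criticalTwoPoint 3 (Pi.single 0 n)`) obeys

  `∃ c > 0, ∀ᶠ n, c ≤ n³ · G(n e₀)²`, i.e. `G(n e₀) ≥ √c · n^{-3/2}` for all large `n`

(`stub_amplitudeFloorDCP`). This is Duminil-Copin–Panis 2025, Theorem 1.5 (`η ≤ 1/2` on `ℤ³`) in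
AMPLITUDE-SHARP form: at the marginal corner `Δ = 3/4` of the window `Δ ∈ [1/2, 3/4]`
(`dimension_window_and_eta`) it says that the slowly varying amplitude `ℓ(n) = n^{3/2} G(n e₀)` is bounded
BELOW, so leaf (γ) of the crux ("no Gaussian Möbius limit at `Δ = 3/4`") cannot degenerate through `ℓ → 0`.

Mechanism (the printed proof of DCP25 Thm 1.5, p. 6 of arXiv:2404.05700, with the `o(1)` replaced by
Karamata's theorem along the dyadic scales). Write `g(k) = G(k e₀) > 0`.
* DCP25 **Theorem 1.3** at `β_c`, `d = 3` (tree THEOREM `dcp_criticalTwoPoint_axis_lower_holds`, free state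
  `=` plus state at `β_c` by `twoPointPlus_criticalBeta_eq_twoPointFree_holds`):
  `g(n) ≥ c₁ / (χ_{4n} + n Σ_{1 ≤ k ≤ 2n} k g(k))` for `n ≥ N₁`.
* `χ_{4·2^J} ≤ 1 + K 8^J g(2^J)` — the landed Karamata dyadic shell sums `stub_dyadicShellSums` (p86861) at
  exponent `s = 0` (its covariance hypothesis `S₂(0,2e₀) = 2^{-2Δ} S₂(0,e₀)` is `S_two_unitVec_eq` of the
  scale covariance contained in `IsMoebiusCovariant`), and `1 ≤ 4^J g(2^J)/c₀` by Simon's bound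
  `g(k) ≥ c₀ k^{-2}` (`criticalTwoPoint_bounds_holds`).
* `Σ_{k ≤ 2^{J+1}} k g(k) ≤ C 4^J g(2^J)` for `J ≥ J₁` — Karamata along the axis: on the dyadic block
  `2^j < k ≤ 2^{j+1}` use `k ≤ 2^{j+1}` and `g(k) ≤ g(2^j)` (the axis profile is antitone,
  `criticalTwoPoint_axis_antitone`, Messager–Miracle-Solé), so the block is `≤ 2·4^j g(2^j)`, and
  `4^j g(2^j)` grows geometrically because `g(2^j)/g(2^{j+1}) → 2^{2Δ} < 4` along the dyadic meshes
  (`tendsto_rescaled_dyadic` at `(0,e₀)` and `(0,2e₀)`; regular variation of index `-2Δ > -2`).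
* Feeding both into Theorem 1.3 at `n = 2^J`: `g(2^J) ≥ c₁ / (C' 8^J g(2^J))`, i.e. `8^J g(2^J)² ≥ c₁/C'`;
  de-dyadised by monotonicity: for `2^J ≤ n < 2^{J+1}`, `n³ g(n)² ≥ 8^J g(2^{J+1})² ≥ c₁/(8C')`.

References: H. Duminil-Copin, R. Panis, CMP 406 (2025), arXiv:2404.05700, Theorems 1.3, 1.5 and the proof of
Theorem 1.5 (p. 6) [DuminilCopinPanis2025LowerBounds]; N. H. Bingham, C. M. Goldie, J. L. Teugels, Regular
Variation, CUP (1987), §1.5.6 [BinghamGoldieTeugels1987]; A. Messager, S. Miracle-Solé, J. Stat. Phys. 17 (1977).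
-/

noncomputable section

open Filter Topology Set Finset
open Literature.Probability.LatticeModels
open Summit.CriticalPhenomena.Ising3DConformalLimit.GaussianLimitNotScreenedNegative (dimension_window_and_eta)
open Summit.CriticalPhenomena.Ising3DConformalLimit.Cruxes.GaussianLimitNotScreened.KaramataAmplitudeBlindMerging
  (stub_dyadicShellSums)

namespace Summit.CriticalPhenomena.Ising3DConformalLimit.Cruxes.GaussianLimitNotScreened.FreeRegularVariationDcpWindow

/-- `0 < ⟨σ₀σ_u⟩_{β_c}` on `ℤ³` (Simon–Lieb lower bound off the origin, `= 1` at the origin). [folklore] -/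
private theorem criticalTwoPoint_pos (u : Site 3) : 0 < criticalTwoPoint 3 u := by
  by_cases hu : u = 0
  · rw [hu, criticalTwoPoint_zero']; exact one_pos
  · obtain ⟨c, C, hc, h⟩ := criticalTwoPoint_bounds_holds (d := 3) le_rfl
    have hn : 0 < ‖u‖ := norm_pos_iff.2 hu
    exact lt_of_lt_of_le (mul_pos hc (Real.rpow_pos_of_pos hn _)) (h u hu).1

-- adapted from Theorems/PerfectScreeningGaussianLimitNotScreenedDyadicShellSums.lean (private lemma
-- `eventually_dyadic_le`, line karamata-amplitude-blind-merging)

/-- **Dyadic ratio bound along the axis**: for `s < 3 - 2Δ` there is `θ < 8 · 2^{-s} = 2^{3-s}` with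
`⟨σ₀σ_{2^i e₀}⟩ ≤ θ ⟨σ₀σ_{2^{i+1}e₀}⟩` for all large `i`
(`⟨σ₀σ_{2^i e₀}⟩/⟨σ₀σ_{2^{i+1}e₀}⟩ → 2^{2Δ}` from the limit at `(0,e₀)`, `(0,2e₀)`). [folklore] -/
private theorem eventually_dyadic_le {ρ : ℝ → ℝ} {S : CorrFamily 3} {Δ s : ℝ}
    (hlim : HasPointwiseScalingLimit (criticalCorr 3) ρ S) (hnd : IsNondegenerateTwoPoint S)
    (hs₂eq : S 2 ![0, EuclideanSpace.single (0 : Fin 3) ((2 : ℕ) : ℝ)] =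
      (2 : ℝ) ^ (-(2 : ℝ) * Δ) * S 2 ![0, EuclideanSpace.single (0 : Fin 3) ((1 : ℕ) : ℝ)])
    (hs : s < 3 - 2 * Δ) :
    ∃ θ : ℝ, 0 < θ ∧ θ < 8 * (2 : ℝ) ^ (-s) ∧ ∀ᶠ i : ℕ in atTop,
      criticalTwoPoint 3 (Pi.single (0 : Fin 3) ((2:ℤ) ^ i)) ≤
        θ * criticalTwoPoint 3 (Pi.single (0 : Fin 3) ((2:ℤ) ^ (i + 1))) := by
  set s₁ := S 2 ![0, EuclideanSpace.single (0 : Fin 3) ((1 : ℕ) : ℝ)] with hs₁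
  set s₂ := S 2 ![0, EuclideanSpace.single (0 : Fin 3) ((2 : ℕ) : ℝ)] with hs₂
  have hs₁pos : 0 < s₁ := hnd _ (zero_unitVec_mem_nonCoincident (by norm_num))
  have hs₂pos : 0 < s₂ := hnd _ (zero_unitVec_mem_nonCoincident (by norm_num))
  -- θ₀ = s₁/s₂ = 2^{2Δ} < 2^{3-s} = 8 · 2^{-s}
  set θ₀ : ℝ := s₁ / s₂ with hθ₀def
  have hθ₀ : θ₀ = (2:ℝ) ^ (2 * Δ) := by
    rw [hθ₀def, eq_comm, eq_div_iff hs₂pos.ne', hs₂eq, ← mul_assoc, ← Real.rpow_add two_pos]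
    have : 2 * Δ + -(2:ℝ) * Δ = 0 := by ring
    rw [this, Real.rpow_zero, one_mul]
  have hM : 8 * (2:ℝ) ^ (-s) = (2:ℝ) ^ (3 - s) := by
    rw [show (3:ℝ) - s = 3 + -s by ring, Real.rpow_add two_pos]
    norm_num
  have hθ₀M : θ₀ < 8 * (2:ℝ) ^ (-s) := by
    rw [hθ₀, hM]
    exact Real.rpow_lt_rpow_of_exponent_lt one_lt_two (by linarith)
  have hθ₀pos : 0 < θ₀ := by rw [hθ₀]; positivity
  set θ : ℝ := (θ₀ + 8 * (2:ℝ) ^ (-s)) / 2 with hθdef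
  have hθθ : θ₀ < θ := by rw [hθdef]; linarith
  refine ⟨θ, by rw [hθdef]; linarith, by rw [hθdef]; linarith, ?_⟩
  -- the two dyadic sequences
  have h1 := tendsto_rescaled_dyadic hlim (t := 1) one_ne_zero
  have h2 := tendsto_rescaled_dyadic hlim (t := 2) two_ne_zero
  have hdiv := h1.div h2 hs₂pos.ne'
  have hev := hdiv.eventually_lt_const hθθ
  have hpos := h2.eventually_const_lt hs₂pos
  obtain ⟨N, hN⟩ := eventually_atTop.1 (hev.and hpos)
  refine eventually_atTop.2 ⟨N + 1, fun i hi => ?_⟩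
  obtain ⟨k, rfl⟩ : ∃ k, i = k + 1 := ⟨i - 1, by omega⟩
  obtain ⟨hk1, hk2⟩ := hN k (by omega)
  have e1 : (((1:ℕ):ℤ) * 2 ^ (k + 1)) = (2:ℤ) ^ (k + 1) := by push_cast; ring
  have e2 : (((2:ℕ):ℤ) * 2 ^ (k + 1)) = (2:ℤ) ^ (k + 1 + 1) := by push_cast; ring
  simp only [e1, e2, Pi.div_apply] at hk1 hk2
  set r := ρ ((2:ℝ)⁻¹ ^ (k + 1)) ^ 2 with hr
  set g₁ := criticalTwoPoint 3 (Pi.single (0 : Fin 3) ((2:ℤ) ^ (k + 1))) with hg₁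
  set g₂ := criticalTwoPoint 3 (Pi.single (0 : Fin 3) ((2:ℤ) ^ (k + 1 + 1))) with hg₂
  have hrpos : 0 < r := by
    rcases (sq_nonneg (ρ ((2:ℝ)⁻¹ ^ (k + 1)))).lt_or_eq with h | h
    · exact h
    · exfalso; rw [hr, ← h, zero_mul] at hk2; exact lt_irrefl _ hk2
  rw [div_lt_iff₀ hk2] at hk1
  have h' : r * g₁ < r * (θ * g₂) := by
    calc r * g₁ < θ * (r * g₂) := hk1
      _ = r * (θ * g₂) := by ring
  exact (lt_of_mul_lt_mul_left h' hrpos.le).le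

/-- **Karamata along the axis (the axial sum of DCP25 (1.9) at the dyadic scales).** For a non-degenerate
pointwise limit with `S₂(0,2e₀) = 2^{-2Δ}S₂(0,e₀)` and `Δ < 1` there are `C > 0`, `J₁` with
`Σ_{1 ≤ k ≤ 2·2^J} k ⟨σ₀σ_{k e₀}⟩_{β_c} ≤ C · 4^J · ⟨σ₀σ_{2^J e₀}⟩_{β_c}` for `J ≥ J₁`: the dyadic block
`2^j < k ≤ 2^{j+1}` is `≤ 2·4^j⟨σ₀σ_{2^j e₀}⟩` (axis antitone), and `4^j⟨σ₀σ_{2^j e₀}⟩` grows geometrically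
(ratio `→ 4·2^{-2Δ} > 1`, Karamata index `2 - 2Δ > 0`).
[cite: BinghamGoldieTeugels1987, §1.5.6, Karamata's theorem (direct half)] -/
private theorem axial_sum_le {ρ : ℝ → ℝ} {S : CorrFamily 3} {Δ : ℝ}
    (hlim : HasPointwiseScalingLimit (criticalCorr 3) ρ S) (hnd : IsNondegenerateTwoPoint S)
    (hs₂eq : S 2 ![0, EuclideanSpace.single (0 : Fin 3) ((2 : ℕ) : ℝ)] =
      (2 : ℝ) ^ (-(2 : ℝ) * Δ) * S 2 ![0, EuclideanSpace.single (0 : Fin 3) ((1 : ℕ) : ℝ)])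
    (hΔ : Δ < 1) :
    ∃ C : ℝ, 0 < C ∧ ∃ J₁ : ℕ, ∀ J : ℕ, J₁ ≤ J →
      ∑ k ∈ Finset.Icc (1:ℕ) (2 * 2 ^ J), (k : ℝ) * criticalTwoPoint 3 (Pi.single (0 : Fin 3) (k : ℤ)) ≤
        C * (4 : ℝ) ^ J * criticalTwoPoint 3 (Pi.single (0 : Fin 3) ((2 : ℤ) ^ J)) := by
  obtain ⟨θ, hθ, hθ4, hev⟩ := eventually_dyadic_le hlim hnd hs₂eq (s := 1) (by linarith)
  have hθ4' : θ < 4 := by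
    rw [Real.rpow_neg_one] at hθ4
    norm_num at hθ4
    exact hθ4
  obtain ⟨i₀, hi₀⟩ := eventually_atTop.1 hev
  -- opaque names: `g k = G(k e₀)`, `T J = Σ_{k ≤ 2^J} k g(k)`
  obtain ⟨g, hg⟩ : ∃ g : ℕ → ℝ, ∀ k : ℕ, g k = criticalTwoPoint 3 (Pi.single (0 : Fin 3) (k : ℤ)) :=
    ⟨_, fun _ => rfl⟩
  have hg2 : ∀ j : ℕ, criticalTwoPoint 3 (Pi.single (0 : Fin 3) ((2:ℤ) ^ j)) = g (2 ^ j) := by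
    intro j
    rw [hg]
    push_cast
    rfl
  have hgpos : ∀ k, 0 < g k := fun k => by rw [hg]; exact criticalTwoPoint_pos _
  have hganti : ∀ {a b : ℕ}, a ≤ b → g b ≤ g a := by
    intro a b h
    rw [hg, hg]
    exact criticalTwoPoint_axis_antitone h
  have hgθ : ∀ j, i₀ ≤ j → g (2 ^ j) ≤ θ * g (2 ^ (j + 1)) := by
    intro j hj
    rw [← hg2, ← hg2]
    exact hi₀ j hj
  obtain ⟨T, hT⟩ : ∃ T : ℕ → ℝ, ∀ J, T J = ∑ k ∈ Finset.Icc (1:ℕ) (2 ^ J), (k : ℝ) * g k :=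
    ⟨_, fun _ => rfl⟩
  have h4 : ∀ J : ℕ, (4:ℝ) ^ J = 2 ^ J * 2 ^ J := fun J => by rw [← mul_pow]; norm_num
  -- one-step recurrence: the block `2^J < k ≤ 2^{J+1}` contributes `≤ 2 · 4^J · g(2^J)`
  have hstep : ∀ J, T (J + 1) ≤ T J + 2 * 4 ^ J * g (2 ^ J) := by
    intro J
    have hsub : Finset.Icc (1:ℕ) (2 ^ J) ⊆ Finset.Icc (1:ℕ) (2 ^ (J + 1)) :=
      Finset.Icc_subset_Icc_right (Nat.pow_le_pow_right two_pos (Nat.le_succ J))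
    rw [hT (J + 1), hT J, ← Finset.sum_sdiff hsub, add_comm]
    refine add_le_add le_rfl ?_
    have hterm : ∀ k ∈ Finset.Icc (1:ℕ) (2 ^ (J + 1)) \ Finset.Icc (1:ℕ) (2 ^ J),
        (k : ℝ) * g k ≤ (2:ℝ) ^ (J + 1) * g (2 ^ J) := by
      intro k hk
      rw [Finset.mem_sdiff, Finset.mem_Icc, Finset.mem_Icc] at hk
      obtain ⟨⟨hk1, hk2⟩, hk3⟩ := hk
      have hk4 : 2 ^ J ≤ k := by omega
      have hk2' : (k : ℝ) ≤ (2:ℝ) ^ (J + 1) := by exact_mod_cast hk2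
      exact mul_le_mul hk2' (hganti hk4) (hgpos k).le (by positivity)
    have hcard : (#(Finset.Icc (1:ℕ) (2 ^ (J + 1)) \ Finset.Icc (1:ℕ) (2 ^ J)) : ℝ) ≤ (2:ℝ) ^ J := by
      rw [Finset.card_sdiff_of_subset hsub, Nat.card_Icc, Nat.card_Icc]
      have : 2 ^ (J + 1) + 1 - 1 - (2 ^ J + 1 - 1) = 2 ^ J := by rw [pow_succ]; omega
      rw [this]
      push_cast
      exact le_rfl
    have hblockpos : (0:ℝ) ≤ (2:ℝ) ^ (J + 1) * g (2 ^ J) := by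
      have := hgpos (2 ^ J); positivity
    calc ∑ k ∈ Finset.Icc (1:ℕ) (2 ^ (J + 1)) \ Finset.Icc (1:ℕ) (2 ^ J), (k : ℝ) * g k
        ≤ ∑ _k ∈ Finset.Icc (1:ℕ) (2 ^ (J + 1)) \ Finset.Icc (1:ℕ) (2 ^ J), (2:ℝ) ^ (J + 1) * g (2 ^ J) :=
          Finset.sum_le_sum hterm
      _ = (#(Finset.Icc (1:ℕ) (2 ^ (J + 1)) \ Finset.Icc (1:ℕ) (2 ^ J)) : ℝ) *
            ((2:ℝ) ^ (J + 1) * g (2 ^ J)) := by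
          rw [Finset.sum_const, nsmul_eq_mul]
      _ ≤ (2:ℝ) ^ J * ((2:ℝ) ^ (J + 1) * g (2 ^ J)) := mul_le_mul_of_nonneg_right hcard hblockpos
      _ = 2 * 4 ^ J * g (2 ^ J) := by rw [h4, pow_succ]; ring
  -- the constant and the induction
  set C : ℝ := max (T (i₀ + 1) / (4 ^ i₀ * g (2 ^ i₀))) (8 / (4 - θ)) with hCdef
  have hC2 : 8 / (4 - θ) ≤ C := le_max_right _ _
  have hC1 : T (i₀ + 1) / (4 ^ i₀ * g (2 ^ i₀)) ≤ C := le_max_left _ _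
  have hCpos : 0 < C := lt_of_lt_of_le (div_pos (by norm_num) (by linarith)) hC2
  have hmain : ∀ J, i₀ ≤ J → T (J + 1) ≤ C * 4 ^ J * g (2 ^ J) := by
    intro J hJ
    induction J, hJ using Nat.le_induction with
    | base =>
      have hden : (0:ℝ) < 4 ^ i₀ * g (2 ^ i₀) := by have := hgpos (2 ^ i₀); positivity
      have := (div_le_iff₀ hden).1 hC1
      simpa only [mul_assoc] using this
    | succ J hJ ih =>
      have hθJ := hgθ J hJ
      have hKθ : C * θ + 8 ≤ 4 * C := by
        have h8 : 0 < 4 - θ := by linarith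
        have := (div_le_iff₀ h8).1 hC2
        nlinarith
      have h4J : (0:ℝ) ≤ C * 4 ^ J := by positivity
      have hpos : (0:ℝ) ≤ 4 ^ (J + 1) * g (2 ^ (J + 1)) := by
        have := hgpos (2 ^ (J + 1)); positivity
      calc T (J + 1 + 1) ≤ T (J + 1) + 2 * 4 ^ (J + 1) * g (2 ^ (J + 1)) := hstep (J + 1)
        _ ≤ C * 4 ^ J * g (2 ^ J) + 2 * 4 ^ (J + 1) * g (2 ^ (J + 1)) := by linarith [ih]
        _ ≤ C * 4 ^ J * (θ * g (2 ^ (J + 1))) + 2 * 4 ^ (J + 1) * g (2 ^ (J + 1)) := by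
            linarith [mul_le_mul_of_nonneg_left hθJ h4J]
        _ = (C * θ + 8) / 4 * (4 ^ (J + 1) * g (2 ^ (J + 1))) := by rw [pow_succ]; ring
        _ ≤ (4 * C) / 4 * (4 ^ (J + 1) * g (2 ^ (J + 1))) :=
            mul_le_mul_of_nonneg_right (by linarith) hpos
        _ = C * 4 ^ (J + 1) * g (2 ^ (J + 1)) := by ring
  refine ⟨C, hCpos, i₀, fun J hJ => ?_⟩
  have h := hmain J hJ
  rw [hT, ← hg2 J, show 2 ^ (J + 1) = 2 * 2 ^ J by ring] at h
  simpa only [hg] using h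

/-- **The DCP floor at the dyadic scales.** For a non-degenerate Möbius-covariant pointwise limit of
`criticalCorr 3`: `∃ c > 0, ∀ J ≥ J₀, c ≤ 8^J ⟨σ₀σ_{2^J e₀}⟩²_{β_c}` — Duminil-Copin–Panis Theorem 1.3 at
`n = 2^J` with its denominator bounded by `C' 8^J ⟨σ₀σ_{2^J e₀}⟩` (box sum: `stub_dyadicShellSums` at `s = 0`
and Simon's lower bound; axial sum: `axial_sum_le`).
[cite: DuminilCopinPanis2025LowerBounds, Theorem 1.3 and proof of Theorem 1.5 (arXiv:2404.05700 p. 6)] -/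
private theorem dyadic_floor {ρ : ℝ → ℝ} {Δ : ℝ} {S : CorrFamily 3}
    (hρ : ∀ δ ∈ Set.Ioc (0:ℝ) 1, 0 < ρ δ) (hlim : HasPointwiseScalingLimit (criticalCorr 3) ρ S)
    (hnd : IsNondegenerateTwoPoint S) (hM : IsMoebiusCovariant Δ S) :
    ∃ c : ℝ, 0 < c ∧ ∃ J₀ : ℕ, ∀ J : ℕ, J₀ ≤ J →
      c ≤ (8 : ℝ) ^ J * criticalTwoPoint 3 (Pi.single (0 : Fin 3) ((2 : ℤ) ^ J)) ^ 2 := by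
  have hsc := hM.isScaleCovariant
  have hΔ : Δ ≤ 3 / 4 := (dimension_window_and_eta hρ hlim hnd hsc).1.2
  have hs₂eq := S_two_unitVec_eq hsc
  -- (1) the box sums at exponent `s = 0` (Karamata dyadic shell sums, landed)
  obtain ⟨K, hK, i₀, hbox⟩ := stub_dyadicShellSums ρ S Δ hlim hnd hs₂eq 0 le_rfl (by linarith)
  -- (2) the axial sums
  obtain ⟨C, hC, J₁, hax⟩ := axial_sum_le hlim hnd hs₂eq (by linarith)
  -- (3) Simon's lower bound `c₀ ‖x‖^{-2} ≤ G(x)`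
  obtain ⟨c₀, C₀, hc₀, hbnd⟩ := criticalTwoPoint_bounds_holds (d := 3) le_rfl
  -- (4) Duminil-Copin–Panis Theorem 1.3 at `β_c`, `d = 3` (free state = plus state at `β_c`)
  obtain ⟨c₁, hc₁, N₁, -, hdcp⟩ := dcp_criticalTwoPoint_axis_lower_holds (d := 3) le_rfl
  have hGeq : ∀ x, criticalTwoPoint 3 x = twoPointFree 3 (criticalBeta 3) x :=
    twoPointPlus_criticalBeta_eq_twoPointFree_holds (d := 3) le_rfl
  have hF : twoPointFree 3 (criticalBeta 3) = criticalTwoPoint 3 := funext fun x => (hGeq x).symm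
  have hC'pos : 0 < 1 / c₀ + K + C := by positivity
  refine ⟨c₁ / (1 / c₀ + K + C), div_pos hc₁ hC'pos, max (max i₀ J₁) N₁, fun J hJ => ?_⟩
  have hi₀ : i₀ ≤ J := le_trans (le_max_left _ _) (le_trans (le_max_left _ _) hJ)
  have hJ₁ : J₁ ≤ J := le_trans (le_max_right _ _) (le_trans (le_max_left _ _) hJ)
  have hN₁ : N₁ ≤ 2 ^ J := le_trans (le_trans (le_max_right _ _) hJ) Nat.lt_two_pow_self.le
  -- elementary identities
  have h4 : ((2:ℝ) ^ J) ^ 2 = (4:ℝ) ^ J := by rw [← pow_mul, mul_comm, pow_mul]; norm_num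
  have h8 : (2:ℝ) ^ J * 4 ^ J = 8 ^ J := by rw [← mul_pow]; norm_num
  have h48 : (4:ℝ) ^ J ≤ 8 ^ J := pow_le_pow_left₀ (by norm_num) (by norm_num) J
  -- Theorem 1.3 at `n = 2^J`, rewritten for `criticalTwoPoint 3` and the axis `Pi.single 0`
  have h13 := hdcp (2 ^ J) hN₁
  have hcastR : ((2 ^ J : ℕ) : ℝ) = (2:ℝ) ^ J := by simp only [Nat.cast_pow, Nat.cast_ofNat]
  have hcastZ : ((2 ^ J : ℕ) : ℤ) = (2:ℤ) ^ J := by simp only [Nat.cast_pow, Nat.cast_ofNat]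
  rw [show (3 - 2 : ℕ) = 1 from rfl, pow_one, hF] at h13
  simp only [Fin.mk_zero] at h13
  have hDpos := dcp_denominator_pos (F := criticalTwoPoint 3) criticalTwoPoint_zero'
    criticalTwoPoint_nonneg' (0 : Fin 3) (2 ^ J)
  have hineq := (div_le_iff₀ hDpos).1 h13
  rw [hcastR, hcastZ] at hineq
  -- the pieces of the denominator
  have hnormx : ‖(Pi.single (0 : Fin 3) ((2:ℤ) ^ J) : Site 3)‖ = (2:ℝ) ^ J := by
    rw [norm_single_axis]; push_cast; exact abs_of_pos (by positivity)
  have hx0 : (Pi.single (0 : Fin 3) ((2:ℤ) ^ J) : Site 3) ≠ 0 := by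
    rw [← norm_pos_iff, hnormx]; positivity
  have hlow : c₀ ≤ (4:ℝ) ^ J * criticalTwoPoint 3 (Pi.single (0 : Fin 3) ((2:ℤ) ^ J)) := by
    have h := (hbnd _ hx0).1
    rw [hnormx, show (-(((3:ℕ):ℝ) - 1)) = -(2:ℝ) by norm_num, Real.rpow_neg (by positivity),
      Real.rpow_two, h4, ← div_eq_mul_inv, div_le_iff₀ (by positivity)] at h
    linarith [h]
  have hbox' := hbox J hi₀
  simp only [neg_zero, Real.rpow_zero, one_mul, zero_mul, mul_one] at hbox'
  rw [show 2 ^ (J + 2) = 4 * 2 ^ J by ring] at hbox'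
  have hax' := hax J hJ₁
  -- abbreviate `g = G(2^J e₀)`
  set g : ℝ := criticalTwoPoint 3 (Pi.single (0 : Fin 3) ((2:ℤ) ^ J)) with hgdef
  have hgpos : 0 < g := criticalTwoPoint_pos _
  have hchi : ∑ x ∈ box 3 (4 * 2 ^ J), criticalTwoPoint 3 x ≤ (1 / c₀ + K) * 8 ^ J * g := by
    rw [← Finset.add_sum_erase _ _ (zero_mem_box 3 (4 * 2 ^ J)), criticalTwoPoint_zero']
    have h1 : (1:ℝ) ≤ 1 / c₀ * 8 ^ J * g := by
      rw [one_div, mul_assoc, ← div_eq_inv_mul, le_div_iff₀ hc₀, one_mul]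
      calc c₀ ≤ 4 ^ J * g := hlow
        _ ≤ 8 ^ J * g := mul_le_mul_of_nonneg_right h48 hgpos.le
    calc 1 + ∑ x ∈ (box 3 (4 * 2 ^ J)).erase 0, criticalTwoPoint 3 x
        ≤ 1 / c₀ * 8 ^ J * g + K * 8 ^ J * g := add_le_add h1 hbox'
      _ = (1 / c₀ + K) * 8 ^ J * g := by ring
  have hD : (∑ x ∈ box 3 (4 * 2 ^ J), criticalTwoPoint 3 x) +
      (2:ℝ) ^ J * ∑ k ∈ Finset.Icc (1:ℕ) (2 * 2 ^ J),
        (k : ℝ) * criticalTwoPoint 3 (Pi.single (0 : Fin 3) (k : ℤ)) ≤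
      (1 / c₀ + K) * 8 ^ J * g + (2:ℝ) ^ J * (C * 4 ^ J * g) :=
    add_le_add hchi (mul_le_mul_of_nonneg_left hax' (by positivity))
  rw [div_le_iff₀ hC'pos]
  calc c₁ ≤ g * ((∑ x ∈ box 3 (4 * 2 ^ J), criticalTwoPoint 3 x) +
        (2:ℝ) ^ J * ∑ k ∈ Finset.Icc (1:ℕ) (2 * 2 ^ J),
          (k : ℝ) * criticalTwoPoint 3 (Pi.single (0 : Fin 3) (k : ℤ))) := hineq
    _ ≤ g * ((1 / c₀ + K) * 8 ^ J * g + (2:ℝ) ^ J * (C * 4 ^ J * g)) := mul_le_mul_of_nonneg_left hD hgpos.le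
    _ = 8 ^ J * g ^ 2 * (1 / c₀ + K + C) := by rw [← h8]; ring

/-- **BOOKKEEPING STUB (P1) — THE AMPLITUDE-SHARP DCP FLOOR.** For every non-degenerate Möbius-covariant pointwise
scaling limit of `criticalCorr 3` (any `Δ`, any `ρ`; no Gaussianity) the axial critical two-point function obeys
`n³ ⟨σ₀σ_{n e₀}⟩² ≥ c` eventually, i.e. `⟨σ₀σ_{n e₀}⟩_{β_c} ≥ √c · n^{-3/2}` — Duminil-Copin–Panis 2025 Thm 1.3
(tree THEOREM `dcp_criticalTwoPoint_axis_lower_holds`) fed with the Karamata dyadic shell sums of the line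
karamata-amplitude-blind-merging (`stub_dyadicShellSums`, p86861: `χ_{4n} ≲ n³G(ne₀)`) and the axial sum
`n Σ_{k≤2n} k G(ke₀) ≲ n³ G(ne₀)` (regular variation of index `−2Δ ≥ −3/2` along the axis, MMS), then
de-dyadised by the monotonicity of the axis profile. At the corner `Δ = 3/4` this says the slowly varying
amplitude `ℓ(n) = n^{3/2}G(ne₀)` is BOUNDED BELOW (DCP Thm 1.5 in amplitude-sharp form), so STUB (γ) is exactly
"no Gaussian Möbius limit at `Δ = 3/4` with amplitude `ℓ ≍≥ 1`"; at `Δ < 3/4` it is implied by the profile.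
[cite: DuminilCopinPanis2025LowerBounds, Theorem 1.3 and proof of Theorem 1.5 (arXiv:2404.05700 p. 6)] -/
theorem stub_amplitudeFloorDCP :
    ∀ (ρ : ℝ → ℝ) (Δ : ℝ) (S : CorrFamily 3), (∀ δ ∈ Set.Ioc (0:ℝ) 1, 0 < ρ δ) →
      HasPointwiseScalingLimit (criticalCorr 3) ρ S → IsNondegenerateTwoPoint S →
      IsMoebiusCovariant Δ S →
      ∃ c : ℝ, 0 < c ∧ ∀ᶠ n : ℕ in atTop,
        c ≤ (n : ℝ) ^ 3 * criticalTwoPoint 3 (Pi.single 0 (n : ℤ)) ^ 2 := by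
  intro ρ Δ S hρ hlim hnd hM
  obtain ⟨c, hc, J₀, hJ⟩ := dyadic_floor hρ hlim hnd hM
  refine ⟨c / 8, by positivity, eventually_atTop.2 ⟨2 ^ J₀, fun n hn => ?_⟩⟩
  have hn0 : n ≠ 0 := by have := Nat.one_le_two_pow (n := J₀); omega
  -- `2^J ≤ n < 2^{J+1}` with `J = log₂ n ≥ J₀`
  set J := Nat.log 2 n with hJdef
  have h1 : 2 ^ J ≤ n := Nat.pow_log_le_self 2 hn0
  have h2 : n < 2 ^ (J + 1) := Nat.lt_pow_succ_log_self one_lt_two n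
  have h3 : J₀ ≤ J := Nat.le_log_of_pow_le one_lt_two hn
  have hfloor := hJ (J + 1) (by omega)
  have hmono : criticalTwoPoint 3 (Pi.single (0 : Fin 3) ((2:ℤ) ^ (J + 1))) ≤
      criticalTwoPoint 3 (Pi.single (0 : Fin 3) (n : ℤ)) := by
    have h := criticalTwoPoint_axis_antitone h2.le
    simp only [Nat.cast_pow, Nat.cast_ofNat] at h
    exact h
  have hpos : 0 ≤ criticalTwoPoint 3 (Pi.single (0 : Fin 3) ((2:ℤ) ^ (J + 1))) :=
    criticalTwoPoint_nonneg' _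
  have h1' : (2:ℝ) ^ J ≤ n := by exact_mod_cast h1
  have h8 : ((2:ℝ) ^ J) ^ 3 = (8:ℝ) ^ J := by rw [← pow_mul, mul_comm, pow_mul]; norm_num
  calc c / 8 ≤ (8:ℝ) ^ J * criticalTwoPoint 3 (Pi.single (0 : Fin 3) ((2:ℤ) ^ (J + 1))) ^ 2 := by
        rw [div_le_iff₀ (by norm_num : (0:ℝ) < 8)]
        calc c ≤ 8 ^ (J + 1) * criticalTwoPoint 3 (Pi.single (0 : Fin 3) ((2:ℤ) ^ (J + 1))) ^ 2 := hfloor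
          _ = 8 ^ J * criticalTwoPoint 3 (Pi.single (0 : Fin 3) ((2:ℤ) ^ (J + 1))) ^ 2 * 8 := by
              rw [pow_succ]; ring
    _ = ((2:ℝ) ^ J) ^ 3 * criticalTwoPoint 3 (Pi.single (0 : Fin 3) ((2:ℤ) ^ (J + 1))) ^ 2 := by rw [h8]
    _ ≤ (n : ℝ) ^ 3 * criticalTwoPoint 3 (Pi.single 0 (n : ℤ)) ^ 2 :=
        mul_le_mul (pow_le_pow_left₀ (by positivity) h1' 3) (pow_le_pow_left₀ hpos hmono 2)
          (by positivity) (by positivity)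

/-! ## Leaf (γ) audit (lead c5 wave, 2026-08-17)
Theorems under `Theorems/` concluding `HasNontrivialU4 S` from `IsMoebiusCovariant (3/4) S` (leaf (γ)
`stub_noMarginalGaussianLimit`), each with the OPEN hypothesis it carries:
`KaramataAmplitudeBlindMerging.noMarginalGaussianLimit_of_windowBelowHalf` (FatSpreadCluster) ⟸ `WindowBelowHalf`
= item 5507; `…_of_eta_ne_half` ⟸ `¬ HasIsingExponentEta 3 (1/2)` (⟸ 5507 by `eta_ne_half_of_windowBelowHalf`;
⟸ `CertifiedWindow` = item 5504 by `Theorems.windowBelowHalf_of_certifiedWindow` + landed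
`criticalStateFeasible_proof`); `…_of_gaussianLimitIsFree` ⟸ `GaussianLimitIsFree` = item 2601;
`FreeRegularVariationDcpWindow.gaussianLimitNotScreened_of_interlacing_of_subPtolemyFloor` (InterlacingBridges,
whole crux hence (γ)) ⟸ `Interlacing ∧ SubPtolemyFloor` = items 15702 ∧ 15703. `ledger workitem get`: 5507, 5504,
2601, 15702, 15703 all `open` (unclaimed) at this wave — nearest payer 5507. What `stub_amplitudeFloorDCP` adds: at
`Δ = 3/4` the amplitude `ℓ(n) = n^{3/2}⟨σ₀σ_{ne₀}⟩ ≥ √c` eventually (no `ℓ → 0` degeneration), so (γ) = "no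
Gaussian Möbius limit of `criticalCorr 3` at the corner with `ℓ ≳ 1`"; (γ) itself stays blocked on item 5507. -/

end Summit.CriticalPhenomena.Ising3DConformalLimit.Cruxes.GaussianLimitNotScreened.FreeRegularVariationDcpWindow

end
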